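import Literature.NumberTheory.ConnesConsani2021.ProlateEigenvalueSigns
import Literature.NumberTheory.ConnesConsani2021.ProlateEigenvalueVirial
import HarnessLib

/-!
# Connes–Consani 2021, §4: `|λ(n)|` is strictly decreasing (clause 3 of `CC2021_sec4_lambda_basic`), and the discharge `CC2021_sec4_lambda_basic_holds` — PROVED

RH-FREE corpus literature (label, line 1): classical analysis of the prolate spheroidal wave
functions of bandwidth `c = 2π` (Slepian–Pollak 1961); no zeta zeros, no positivity statement, no
claim about RH anywhere in this file.  Cell `rh-crit`, sub-cell `cc/`, seat t10 (g2); bears_on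
W-C/W-P only as §4 bookkeeping behind the apex input (A) (consumers of the named fact
`CC2021_sec4_lambda_basic`: `ArchimedeanTraceFormulaProofs`).  WHAT THIS IS NOT: a statement about
RH — nothing here bears on the truth of RH.  THEOREMS ONLY: no definition, no new named fact.

A. Connes, C. Consani, *Weil positivity and trace formula, the archimedean place*, Selecta Math.
(N.S.) 27 (2021) 77 = arXiv:2006.13771 [bib `ConnesConsani2021`], §4 p. 16 (arXiv p0016:L22–L25):
"`λ(0) = 0.999971, λ(1) = −0.979485, λ(2) = 0.524086, …` and all the further ones decay very fast to
`0`": the moduli `|λ(n)|` are STRICTLY DECREASING — "`|λ_0| > |λ_1| > ⋯`", the eigenvalues of the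
finite Fourier transform being simple [Slepian–Pollak 1961, §III; Rokhlin–Xiao 2007, Thm. 3 p. 109;
Hogan–Lakey 2012, Thm. 1.2.8; Connes 2026 Letter, Fact 6.3 "`1 > ν_0 > ν_1 > ⋯ > 0`, simple"].
This is CLAUSE 3 `StrictAnti (fun n ↦ |λ(n)|)` of `CC2021_sec4_lambda_basic`; with clause 1
(`ProlateEigenvalueSigns.lean`), clause 2 (`abs_prolateEigen_lt_one`, seat t3) and clause 4
(`tendsto_prolateEigen_zero`, seat gm-t14) it yields **`CC2021_sec4_lambda_basic_holds`** (append
No. 1: the first version of this file proved the Wronskian half and the reduction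
`sq_prolateEigen_succ_lt_of_virial` with the virial identity (D) as an explicit hypothesis; the append
imports (D) from `ProlateEigenvalueVirial.lean`, seat t1 g2 of the cell, and closes).

## The proof given here (fixed bandwidth; no continuation in `c`)

The printed proofs of the ordering are by continuation in the bandwidth from the Legendre limit
([Hogan–Lakey 2012, p. 27 and §1.4 p. 43], following [Slepian–Pollak 1961]); we argue at fixed
`c = 2π` instead.  For CONSECUTIVE indices `k, k+1` let `u = u_b`, `v = u_{b′}` be the principal
Frobenius solutions (`frobSol 1 b`, normalised `u(1) = v(1) = 1`) at the critical parameters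
`b < b′` with `k`, `k+1` zeros in `(0,1)`, and `𝒲 := (1−x²)(u v′ − u′ v)`, so `𝒲′ = (b − b′)uv`.
* **Wronskian positivity** (`wronskian_frobSol_pos`): `𝒲 > 0` on `(0,1)`.  If `𝒲(t⋆) = 0` for some
  `t⋆ ∈ (0,1)`, Sturm's comparison step — in the tree's form `sturm_gap_pos_Icc` (seat of
  `ProlateShooting.lean`), here with the extra admissible end-point condition "`𝒲 = 0`" — puts a zero
  of `v` in each of the `k+2` gaps cut out of `(0,1)` by the zeros of `u` and `t⋆` (left ends `0`,
  the zeros, `t⋆`), i.e. `v` would have `k+2 > k+1` zeros; `𝒲 > 0` near `0` because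
  `𝒲′(0) = (b−b′)u(0)v(0) > 0` (`sign u(0) = (−1)ᵏ`, `sign v(0) = (−1)ᵏ⁺¹`).
* Hence (`integral_sq_mul_frobSol_mul_pos`) `(b − b′)∫₀¹x²uv = −2∫₀¹ x𝒲(x)dx < 0`, i.e.
  `∫₀¹ x² u v > 0`, i.e. `∫_{−1}^{1} x²ψ_kψ_{k+1}` has the sign of `ψ_k(1)ψ_{k+1}(1)`.
* The **virial identity** `(λ_k² − λ_{k+1}²)·∫_{−1}^{1}x²ψ_kψ_{k+1} = λ_kλ_{k+1}(χ_k − χ_{k+1})ψ_k(1)ψ_{k+1}(1)/(2π)²`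
  (file `ProlateEigenvalueVirial.lean`; [Hogan–Lakey 2012, Thm. 2.6.1–2.6.2, from Xiao–Rokhlin–Yarvin
  2001]) and `λ_kλ_{k+1} < 0` (clause 1) then give `λ_k² > λ_{k+1}²`.

Append No. 2 (`## Index bookkeeping from the ordering of the moduli`): the corollaries the cell's
archimedean-kernel certificate consumes — antitone `|λ(n)|`, `λ(n)²`, `λ(n)²/(1−λ(n)²)`; selection by
modulus (`lt_of_abs_prolateEigen_lt`: `|λ(N)| < |λ(m)| → m < N`); and the **λ-route to identification by
index** (`prolate_index_eq_of_abs_prolateEigen_strictAnti`/`_dominates`,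
`eq_prolateFun_of_abs_eigen_strictAnti`, `eq_prolateFun_of_sq_eigen_gap`): certified even members whose
index-free quotients `μ_j = (∫_{−1}^{1}u_j)/u_j(0)` have strictly decreasing moduli dominating `|λ(N)|`,
or leaving a trace gap `Λ − Σ_{j<N} μ_j² < μ_j²`, are `prolateFun 0, …, prolateFun (N−1)` — the
`|λ|`-twin of `ArchKernelModeIdentification.lean`'s `χ`-ordering route.

References for the statements: [cite: ConnesConsani2021, §4 p. 16 (arXiv p0016:L22–L25)];
[cite: SlepianPollak1961, §III]; [cite: RokhlinXiao2007, Thm. 3 p. 109];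
[cite: HoganLakey2012, Thm. 1.2.8 and Thm. 2.1.15]; Sturm's comparison theorem
[cite: Hartman2002, Ch. XI §3 Thm 3.1; CoddingtonLevinson1955, Ch. 8 §1 Thm 1.1].  The fixed-`c`
route is this file's own (elementary; auxiliary lemmas tagged [folklore]).
-/

noncomputable section

open Real Set Filter Topology MeasureTheory intervalIntegral

namespace Literature.NumberTheory.ConnesConsani2021

open Literature.NumberTheory.LFunctions

/-! ## Sturm's comparison step with the admissible end-point condition "`𝒲 = 0`" -/

/-- Sturm's comparison step on a gap `[a, b] ⊆ [−λ, λ]` (as the tree's `sturm_gap_pos_Icc`), the end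
points being zeros of `f` OR zeros of the weighted Wronskian `𝒲 = f·(λ²−x²)g₁ − (λ²−x²)f₁·g`
(this covers the singular end points `±λ` and a common critical point `f₁ = g₁ = 0`): `f, g > 0` on
`(a, b)` is impossible when `χ_f < χ_g`.
[cite: Hartman2002, Ch. XI §3 Thm 3.1; CoddingtonLevinson1955, Ch. 8 §1 Thm 1.1] -/
private theorem sturm_gap_pos_W {lam χf χg a b : ℝ} {f g f₁ g₁ : ℝ → ℝ} (hχ : χf < χg)
    (hfc : ContinuousOn f (Icc a b)) (hgc : ContinuousOn g (Icc a b))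
    (hf₁c : ContinuousOn f₁ (Icc a b)) (hg₁c : ContinuousOn g₁ (Icc a b))
    (hfd : ∀ x ∈ Icc a b, HasDerivAt f (f₁ x) x)
    (hgd : ∀ x ∈ Ioo a b, HasDerivAt g (g₁ x) x)
    (hfe : ∀ x ∈ Ioo a b,
      HasDerivAt (fun y ↦ (lam ^ 2 - y ^ 2) * f₁ y) (((2 * π * lam * x) ^ 2 - χf) * f x) x)
    (hge : ∀ x ∈ Ioo a b,
      HasDerivAt (fun y ↦ (lam ^ 2 - y ^ 2) * g₁ y) (((2 * π * lam * x) ^ 2 - χg) * g x) x)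
    (ha : -lam ≤ a) (hab : a < b) (hb : b ≤ lam)
    (hfa : f a = 0 ∨ f a * ((lam ^ 2 - a ^ 2) * g₁ a) - (lam ^ 2 - a ^ 2) * f₁ a * g a = 0)
    (hfb : f b = 0 ∨ f b * ((lam ^ 2 - b ^ 2) * g₁ b) - (lam ^ 2 - b ^ 2) * f₁ b * g b = 0)
    (hfpos : ∀ x ∈ Ioo a b, 0 < f x) (hgpos : ∀ x ∈ Ioo a b, 0 < g x) : False := by
  set W : ℝ → ℝ := fun x ↦ f x * ((lam ^ 2 - x ^ 2) * g₁ x) - (lam ^ 2 - x ^ 2) * f₁ x * g x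
    with hW
  have hWd : ∀ x ∈ Ioo a b, HasDerivAt W ((χf - χg) * f x * g x) x := by
    intro x hx
    have h1 : HasDerivAt (fun y ↦ f y * ((lam ^ 2 - y ^ 2) * g₁ y))
        (f₁ x * ((lam ^ 2 - x ^ 2) * g₁ x) + f x * (((2 * π * lam * x) ^ 2 - χg) * g x)) x :=
      (hfd x (Ioo_subset_Icc_self hx)).mul (hge x hx)
    have h2 : HasDerivAt (fun y ↦ (lam ^ 2 - y ^ 2) * f₁ y * g y)
        (((2 * π * lam * x) ^ 2 - χf) * f x * g x + (lam ^ 2 - x ^ 2) * f₁ x * g₁ x) x :=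
      (hfe x hx).mul (hgd x hx)
    exact (h1.sub h2).congr_deriv (by ring)
  have hp : Continuous fun x : ℝ ↦ lam ^ 2 - x ^ 2 := by fun_prop
  have hWc : ContinuousOn W (Icc a b) :=
    (hfc.mul (hp.continuousOn.mul hg₁c)).sub ((hp.continuousOn.mul hf₁c).mul hgc)
  have hprod : ContinuousOn (fun x ↦ f x * g x) (Icc a b) := hfc.mul hgc
  have hint : IntervalIntegrable (fun x ↦ (χf - χg) * f x * g x) volume a b := by
    apply ContinuousOn.intervalIntegrable
    rw [uIcc_of_le hab.le]
    exact (continuousOn_const.mul hfc).mul hgc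
  have hftc : ∫ x in a..b, (χf - χg) * f x * g x = W b - W a :=
    integral_eq_sub_of_hasDerivAt_of_le hab.le hWc hWd hint
  have hneg : ∫ x in a..b, (χf - χg) * f x * g x < 0 := by
    have hpos : 0 < ∫ x in a..b, (χg - χf) * (f x * g x) := by
      apply intervalIntegral_pos_of_pos_on
      · apply ContinuousOn.intervalIntegrable
        rw [uIcc_of_le hab.le]
        exact continuousOn_const.mul hprod
      · intro x hx
        exact mul_pos (sub_pos.mpr hχ) (mul_pos (hfpos x hx) (hgpos x hx))
      · exact hab
    have : ∫ x in a..b, (χf - χg) * f x * g x = -∫ x in a..b, (χg - χf) * (f x * g x) := by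
      rw [← intervalIntegral.integral_neg]
      congr 1; ext x; ring
    linarith
  have hga : 0 ≤ g a := by
    haveI : (𝓝[Ioo a b] a).NeBot := left_nhdsWithin_Ioo_neBot hab
    have ht : Tendsto g (𝓝[Ioo a b] a) (𝓝 (g a)) :=
      ((hgc.continuousWithinAt ⟨le_rfl, hab.le⟩).mono Ioo_subset_Icc_self).tendsto
    exact ge_of_tendsto ht (by
      filter_upwards [self_mem_nhdsWithin] with x hx using (hgpos x hx).le)
  have hgb : 0 ≤ g b := by
    haveI : (𝓝[Ioo a b] b).NeBot := right_nhdsWithin_Ioo_neBot hab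
    have ht : Tendsto g (𝓝[Ioo a b] b) (𝓝 (g b)) :=
      ((hgc.continuousWithinAt ⟨hab.le, le_rfl⟩).mono Ioo_subset_Icc_self).tendsto
    exact ge_of_tendsto ht (by
      filter_upwards [self_mem_nhdsWithin] with x hx using (hgpos x hx).le)
  have hWa : W a ≤ 0 := by
    rcases hfa with hfa0 | hWa0
    · have hf₁a : 0 ≤ f₁ a :=
        hasDerivAt_nonneg_of_pos_right (hfd a ⟨le_rfl, hab.le⟩) hfa0 hab hfpos
      have hpa : 0 ≤ lam ^ 2 - a ^ 2 := by nlinarith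
      have : W a = -((lam ^ 2 - a ^ 2) * f₁ a * g a) := by simp only [hW, hfa0, zero_mul, zero_sub]
      rw [this, neg_nonpos]
      exact mul_nonneg (mul_nonneg hpa hf₁a) hga
    · exact le_of_eq hWa0
  have hWb : 0 ≤ W b := by
    rcases hfb with hfb0 | hWb0
    · have hf₁b : f₁ b ≤ 0 :=
        hasDerivAt_nonpos_of_pos_left (hfd b ⟨hab.le, le_rfl⟩) hfb0 hab hfpos
      have hpb : 0 ≤ lam ^ 2 - b ^ 2 := by nlinarith
      have : W b = -((lam ^ 2 - b ^ 2) * f₁ b * g b) := by simp only [hW, hfb0, zero_mul, zero_sub]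
      rw [this, neg_nonneg]
      have : (lam ^ 2 - b ^ 2) * f₁ b ≤ 0 := mul_nonpos_of_nonneg_of_nonpos hpb hf₁b
      exact mul_nonpos_of_nonpos_of_nonneg this hgb
    · exact ge_of_eq hWb0
  linarith

/-- Sturm's comparison step (end points: zeros of `f` or of `𝒲`), for functions of constant signs on
the gap. [cite: Hartman2002, Ch. XI §3 Thm 3.1; CoddingtonLevinson1955, Ch. 8 §1 Thm 1.1] -/
private theorem sturm_gap_W {lam χf χg a b : ℝ} {f g f₁ g₁ : ℝ → ℝ} (hχ : χf < χg)
    (hfc : ContinuousOn f (Icc a b)) (hgc : ContinuousOn g (Icc a b))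
    (hf₁c : ContinuousOn f₁ (Icc a b)) (hg₁c : ContinuousOn g₁ (Icc a b))
    (hfd : ∀ x ∈ Icc a b, HasDerivAt f (f₁ x) x)
    (hgd : ∀ x ∈ Ioo a b, HasDerivAt g (g₁ x) x)
    (hfe : ∀ x ∈ Ioo a b,
      HasDerivAt (fun y ↦ (lam ^ 2 - y ^ 2) * f₁ y) (((2 * π * lam * x) ^ 2 - χf) * f x) x)
    (hge : ∀ x ∈ Ioo a b,
      HasDerivAt (fun y ↦ (lam ^ 2 - y ^ 2) * g₁ y) (((2 * π * lam * x) ^ 2 - χg) * g x) x)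
    (ha : -lam ≤ a) (hab : a < b) (hb : b ≤ lam)
    (hfa : f a = 0 ∨ f a * ((lam ^ 2 - a ^ 2) * g₁ a) - (lam ^ 2 - a ^ 2) * f₁ a * g a = 0)
    (hfb : f b = 0 ∨ f b * ((lam ^ 2 - b ^ 2) * g₁ b) - (lam ^ 2 - b ^ 2) * f₁ b * g b = 0)
    (hfs : (∀ x ∈ Ioo a b, 0 < f x) ∨ (∀ x ∈ Ioo a b, f x < 0))
    (hgs : (∀ x ∈ Ioo a b, 0 < g x) ∨ (∀ x ∈ Ioo a b, g x < 0)) : False := by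
  have negd : ∀ {u u₁ : ℝ → ℝ} {T : Set ℝ}, (∀ x ∈ T, HasDerivAt u (u₁ x) x) →
      (∀ x ∈ T, HasDerivAt (fun y ↦ -u y) ((fun y ↦ -u₁ y) x) x) :=
    fun hu x hx ↦ (hu x hx).neg
  have nege : ∀ {u u₁ : ℝ → ℝ} {χ : ℝ},
      (∀ x ∈ Ioo a b,
        HasDerivAt (fun y ↦ (lam ^ 2 - y ^ 2) * u₁ y) (((2 * π * lam * x) ^ 2 - χ) * u x) x) →
      (∀ x ∈ Ioo a b,
        HasDerivAt (fun y ↦ (lam ^ 2 - y ^ 2) * (fun y ↦ -u₁ y) y)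
          (((2 * π * lam * x) ^ 2 - χ) * (fun y ↦ -u y) x) x) := by
    intro u u₁ χ hue x hx
    have h := (hue x hx).neg
    refine (h.congr_of_eventuallyEq (Eventually.of_forall fun y ↦ ?_)).congr_deriv ?_
    · simp only [mul_neg, Pi.neg_apply]
    · ring
  -- the end-point disjunctions for the sign-flipped functions
  have endpt : ∀ {u w u₁ w₁ : ℝ → ℝ} {c : ℝ} (su sw : ℝ), (su = 1 ∨ su = -1) → (sw = 1 ∨ sw = -1) →
      (u c = 0 ∨ u c * ((lam ^ 2 - c ^ 2) * w₁ c) - (lam ^ 2 - c ^ 2) * u₁ c * w c = 0) →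
      ((fun y ↦ su * u y) c = 0 ∨ (fun y ↦ su * u y) c * ((lam ^ 2 - c ^ 2) * (fun y ↦ sw * w₁ y) c)
        - (lam ^ 2 - c ^ 2) * (fun y ↦ su * u₁ y) c * (fun y ↦ sw * w y) c = 0) := by
    intro u w u₁ w₁ c su sw hsu hsw h
    rcases h with h | h
    · exact Or.inl (by simp [h])
    · refine Or.inr ?_
      have : (fun y ↦ su * u y) c * ((lam ^ 2 - c ^ 2) * (fun y ↦ sw * w₁ y) c)
          - (lam ^ 2 - c ^ 2) * (fun y ↦ su * u₁ y) c * (fun y ↦ sw * w y) c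
          = su * sw * (u c * ((lam ^ 2 - c ^ 2) * w₁ c) - (lam ^ 2 - c ^ 2) * u₁ c * w c) := by
        simp only []; ring
      rw [this, h, mul_zero]
  -- reduce every sign case to the positive one via `f ↦ s_f f`, `g ↦ s_g g`
  have key : ∀ (sf sg : ℝ), (sf = 1 ∨ sf = -1) → (sg = 1 ∨ sg = -1) →
      (∀ x ∈ Ioo a b, 0 < sf * f x) → (∀ x ∈ Ioo a b, 0 < sg * g x) → False := by
    intro sf sg hsf hsg hfp hgp
    refine sturm_gap_pos_W (f := fun y ↦ sf * f y) (g := fun y ↦ sg * g y)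
      (f₁ := fun y ↦ sf * f₁ y) (g₁ := fun y ↦ sg * g₁ y) hχ
      (continuousOn_const.mul hfc) (continuousOn_const.mul hgc)
      (continuousOn_const.mul hf₁c) (continuousOn_const.mul hg₁c)
      (fun x hx ↦ (hfd x hx).const_mul sf) (fun x hx ↦ (hgd x hx).const_mul sg)
      (fun x hx ↦ ?_) (fun x hx ↦ ?_) ha hab hb (endpt sf sg hsf hsg hfa) (endpt sf sg hsf hsg hfb)
      hfp hgp
    · have h := (hfe x hx).const_mul sf
      refine (h.congr_of_eventuallyEq (Eventually.of_forall fun y ↦ ?_)).congr_deriv (by ring)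
      simp only []; ring
    · have h := (hge x hx).const_mul sg
      refine (h.congr_of_eventuallyEq (Eventually.of_forall fun y ↦ ?_)).congr_deriv (by ring)
      simp only []; ring
  rcases hfs with hfp | hfn <;> rcases hgs with hgp | hgn
  · exact key 1 1 (Or.inl rfl) (Or.inl rfl) (fun x hx ↦ by simpa using hfp x hx)
      (fun x hx ↦ by simpa using hgp x hx)
  · exact key 1 (-1) (Or.inl rfl) (Or.inr rfl) (fun x hx ↦ by simpa using hfp x hx)
      (fun x hx ↦ by simpa using hgn x hx)
  · exact key (-1) 1 (Or.inr rfl) (Or.inl rfl) (fun x hx ↦ by simpa using hfn x hx)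
      (fun x hx ↦ by simpa using hgp x hx)
  · exact key (-1) (-1) (Or.inr rfl) (Or.inr rfl) (fun x hx ↦ by simpa using hfn x hx)
      (fun x hx ↦ by simpa using hgn x hx)

/-- Sturm's comparison step as an existence statement: a gap of `f` (no zeros of `f` inside; each end
point a zero of `f` or of the weighted Wronskian `𝒲`) contains a zero of the more oscillatory `g`.
[cite: Hartman2002, Ch. XI §3 Thm 3.1; CoddingtonLevinson1955, Ch. 8 §1 Thm 1.1] -/
private theorem exists_zero_in_gap_W {lam χf χg a b : ℝ} {f g f₁ g₁ : ℝ → ℝ} (hχ : χf < χg)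
    (hfc : ContinuousOn f (Icc a b)) (hgc : ContinuousOn g (Icc a b))
    (hf₁c : ContinuousOn f₁ (Icc a b)) (hg₁c : ContinuousOn g₁ (Icc a b))
    (hfd : ∀ x ∈ Icc a b, HasDerivAt f (f₁ x) x)
    (hgd : ∀ x ∈ Ioo a b, HasDerivAt g (g₁ x) x)
    (hfe : ∀ x ∈ Ioo a b,
      HasDerivAt (fun y ↦ (lam ^ 2 - y ^ 2) * f₁ y) (((2 * π * lam * x) ^ 2 - χf) * f x) x)
    (hge : ∀ x ∈ Ioo a b,
      HasDerivAt (fun y ↦ (lam ^ 2 - y ^ 2) * g₁ y) (((2 * π * lam * x) ^ 2 - χg) * g x) x)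
    (ha : -lam ≤ a) (hab : a < b) (hb : b ≤ lam)
    (hfa : f a = 0 ∨ f a * ((lam ^ 2 - a ^ 2) * g₁ a) - (lam ^ 2 - a ^ 2) * f₁ a * g a = 0)
    (hfb : f b = 0 ∨ f b * ((lam ^ 2 - b ^ 2) * g₁ b) - (lam ^ 2 - b ^ 2) * f₁ b * g b = 0)
    (hfz : ∀ x ∈ Ioo a b, f x ≠ 0) :
    ∃ z ∈ Ioo a b, g z = 0 := by
  by_contra hcon
  push Not at hcon
  have hfs := pos_or_neg_of_ne_zero hab (hfc.mono Ioo_subset_Icc_self) hfz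
  have hgs := pos_or_neg_of_ne_zero hab (hgc.mono Ioo_subset_Icc_self) hcon
  exact sturm_gap_W hχ hfc hgc hf₁c hg₁c hfd hgd hfe hge ha hab hb hfa hfb hfs hgs

/-! ## The zero count that forbids an interior zero of the Wronskian of consecutive eigenfunctions -/

/-- **Gap count.**  Let `u` (parameter `χ`) and `v` (parameter `χ′ > χ`) solve the prolate equation on
`[0, λ]`, with `u′(0)v(0)·… ` — precisely: the weighted Wronskian `𝒲 = u·(λ²−x²)v₁ − (λ²−x²)u₁·v`
vanishes at `0` — and let `P ⊆ (0, λ)` be a finite set of "posts" containing every zero of `u` in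
`(0, λ)`, each post being a zero of `u` or of `𝒲`.  Then `v` has at least `#P + 1` zeros in `(0, λ)`
off the posts: one in each of the gaps `(0, p₁), (p₁, p₂), …, (p_m, λ)` (Sturm's comparison step with
the end-point conditions "zero of `u`", "`𝒲 = 0`", or the singular point `λ`).
[cite: Hartman2002, Ch. XI §3 Cor 3.1; CoddingtonLevinson1955, Ch. 8 §1 Thm 1.2] -/
private theorem ncard_posts_succ_le {lam χ χ' : ℝ} {S T : Set ℝ} {u u₁ u₂ v v₁ v₂ : ℝ → ℝ}
    (hlam : 0 < lam) (hu : IsProlateODESol lam χ S u u₁ u₂) (hv : IsProlateODESol lam χ' T v v₁ v₂)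
    (hS : Icc 0 lam ⊆ S) (hT : Icc 0 lam ⊆ T) (hχ : χ < χ')
    (hZv : {x | x ∈ Ioo 0 lam ∧ v x = 0}.Finite) {P : Set ℝ} (hPf : P.Finite)
    (hPsub : ∀ p ∈ P, p ∈ Ioo 0 lam)
    (hP : ∀ p ∈ P, u p = 0 ∨ u p * ((lam ^ 2 - p ^ 2) * v₁ p) - (lam ^ 2 - p ^ 2) * u₁ p * v p = 0)
    (hZuP : ∀ z ∈ Ioo 0 lam, u z = 0 → z ∈ P)
    (h0 : u 0 * ((lam ^ 2 - 0 ^ 2) * v₁ 0) - (lam ^ 2 - 0 ^ 2) * u₁ 0 * v 0 = 0) :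
    P.ncard + 1 ≤ {x | x ∈ Ioo 0 lam ∧ v x = 0 ∧ x ∉ P}.ncard := by
  set Zv' : Set ℝ := {x | x ∈ Ioo 0 lam ∧ v x = 0 ∧ x ∉ P} with hZv'
  have hZv'f : Zv'.Finite := hZv.subset fun x hx ↦ ⟨hx.1, hx.2.1⟩
  set E : Set ℝ := insert 0 P with hE
  have h0P : (0:ℝ) ∉ P := fun h ↦ lt_irrefl _ (hPsub 0 h).1
  have hEcard : E.ncard = P.ncard + 1 := by rw [hE, ncard_insert_of_notMem h0P hPf]
  have hEf : E.Finite := hPf.insert 0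
  have hEmem : ∀ e ∈ E, e ∈ Ico 0 lam ∧
      (u e = 0 ∨ u e * ((lam ^ 2 - e ^ 2) * v₁ e) - (lam ^ 2 - e ^ 2) * u₁ e * v e = 0) := by
    intro e he
    rcases he with rfl | he
    · exact ⟨⟨le_rfl, hlam⟩, Or.inr h0⟩
    · exact ⟨⟨(hPsub e he).1.le, (hPsub e he).2⟩, hP e he⟩
  -- the right end of the gap starting at `e`
  set R : ℝ → Set ℝ := fun e ↦ {z | z ∈ P ∧ e < z} ∪ {lam} with hR
  have hRf : ∀ e, (R e).Finite := fun e ↦ (hPf.subset (fun z hz ↦ hz.1)).union (finite_singleton _)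
  have hRn : ∀ e, (R e).Nonempty := fun e ↦ ⟨lam, Or.inr rfl⟩
  set nxt : ℝ → ℝ := fun e ↦ sInf (R e) with hnxt
  have hnxt_mem : ∀ e, nxt e ∈ R e := fun e ↦ (hRn e).csInf_mem (hRf e)
  have hnxt_le : ∀ e, ∀ z ∈ R e, nxt e ≤ z := fun e z hz ↦ csInf_le (hRf e).bddBelow hz
  have hnxt_gt : ∀ e ∈ E, e < nxt e := by
    intro e he
    rcases hnxt_mem e with h | h
    · exact h.2
    · rw [h]; exact (hEmem e he).1.2
  have hnxt_lam : ∀ e, nxt e ≤ lam := fun e ↦ hnxt_le e lam (Or.inr rfl)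
  have hnxt_end : ∀ e, nxt e = lam ∨ nxt e ∈ P := by
    intro e
    rcases hnxt_mem e with h | h
    · exact Or.inr h.1
    · exact Or.inl h
  -- no post, hence no zero of `u`, inside a gap
  have hgapP : ∀ e ∈ E, ∀ x ∈ Ioo e (nxt e), x ∉ P := by
    intro e _ x hx hxP
    have := hnxt_le e x (Or.inl ⟨hxP, hx.1⟩)
    linarith [hx.2]
  have hgap : ∀ e ∈ E, ∀ x ∈ Ioo e (nxt e), u x ≠ 0 := by
    intro e he x hx hux
    have hx0 : x ∈ Ioo 0 lam := ⟨by linarith [(hEmem e he).1.1, hx.1], by linarith [hnxt_lam e, hx.2]⟩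
    exact hgapP e he x hx (hZuP x hx0 hux)
  -- a zero of `v` in each gap
  have hex : ∀ e ∈ E, ∃ z ∈ Ioo e (nxt e), v z = 0 := by
    intro e he
    have he0 := (hEmem e he).1.1
    have hsub : Icc e (nxt e) ⊆ Icc 0 lam := Icc_subset_Icc he0 (hnxt_lam e)
    have hsubo : Ioo e (nxt e) ⊆ Icc 0 lam := Ioo_subset_Icc_self.trans hsub
    have hright : u (nxt e) = 0 ∨ u (nxt e) * ((lam ^ 2 - nxt e ^ 2) * v₁ (nxt e))
        - (lam ^ 2 - nxt e ^ 2) * u₁ (nxt e) * v (nxt e) = 0 := by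
      rcases hnxt_end e with h | h
      · refine Or.inr ?_
        have : lam ^ 2 - nxt e ^ 2 = 0 := by rw [h]; ring
        rw [this]; ring
      · exact hP _ h
    exact exists_zero_in_gap_W hχ ((hu.continuousOn).mono (hsub.trans hS))
      ((hv.continuousOn).mono (hsub.trans hT)) ((hu.continuousOn₁).mono (hsub.trans hS))
      ((hv.continuousOn₁).mono (hsub.trans hT)) (fun x hx ↦ hu.hasDerivAt x (hS (hsub hx)))
      (fun x hx ↦ hv.hasDerivAt x (hT (hsubo hx))) (fun x hx ↦ hu.hasDerivAt_flux (hS (hsubo hx)))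
      (fun x hx ↦ hv.hasDerivAt_flux (hT (hsubo hx))) (by linarith) (hnxt_gt e he) (hnxt_lam e)
      (hEmem e he).2 hright (hgap e he)
  choose! z hz using hex
  have hzZv : ∀ e ∈ E, z e ∈ Zv' := by
    intro e he
    obtain ⟨hze, hvz⟩ := hz e he
    exact ⟨⟨by linarith [(hEmem e he).1.1, hze.1], by linarith [hnxt_lam e, hze.2]⟩, hvz,
      hgapP e he (z e) hze⟩
  have hmono : ∀ e₁ ∈ E, ∀ e₂ ∈ E, e₁ < e₂ → z e₁ < z e₂ := by
    intro e₁ he₁ e₂ he₂ hlt'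
    have hn : nxt e₁ ≤ e₂ := by
      rcases he₂ with rfl | he₂P
      · exfalso; linarith [(hEmem e₁ he₁).1.1]
      · exact hnxt_le e₁ e₂ (Or.inl ⟨he₂P, hlt'⟩)
    linarith [(hz e₁ he₁).1.2, (hz e₂ he₂).1.1]
  have hinj : InjOn z E := by
    intro e₁ he₁ e₂ he₂ heq
    by_contra hne
    rcases lt_or_gt_of_ne hne with h | h
    · exact absurd heq (hmono e₁ he₁ e₂ he₂ h).ne
    · exact absurd heq (hmono e₂ he₂ e₁ he₁ h).ne'
  rw [← hEcard]
  exact ncard_le_ncard_of_injOn z hzZv hinj hZv'f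

/-! ## Wronskian positivity for consecutive even prolate functions (Frobenius normalisation) -/

section Consecutive

variable {b b' : ℝ} {k : ℕ}

/-- For `x ∈ [0,1]`: `|1 − x| < 2`, the disc of the Frobenius series. [folklore] -/
private theorem mem_disc {x : ℝ} (hx : x ∈ Icc (0:ℝ) 1) : |1 - x| < 2 * 1 :=
  abs_sub_lt_two_mul_of_mem_Icc one_pos hx

/-- Critical parameters are ordered by the zero count: `k` zeros for `b`, `k+1` zeros for `b′`
force `b < b′` (Sturm monotonicity `frobZeros_mono`). [cite: Hartman2002, Ch. XI §3 Cor 3.1] -/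
theorem lt_of_ncard_zeros_frobSol_succ (hN : {x | x ∈ Ioo (0:ℝ) 1 ∧ frobSol 1 b x = 0}.ncard = k)
    (hN' : {x | x ∈ Ioo (0:ℝ) 1 ∧ frobSol 1 b' x = 0}.ncard = k + 1) : b < b' := by
  by_contra h
  push Not at h
  have := frobZeros_mono one_pos h
  rw [frobZeros_def, frobZeros_def, hN, hN'] at this
  omega

/-- **Wronskian positivity.**  For consecutive critical parameters `b < b′` (`u_b′(0) = u_{b′}′(0) = 0`,
`k` resp. `k+1` zeros in `(0,1)`), the weighted Wronskian
`𝒲(x) = u_b(x)·(1−x²)u_{b′}′(x) − (1−x²)u_b′(x)·u_{b′}(x)` is positive on `(0,1)`.  (An interior zero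
`t⋆` of `𝒲` would make `u_{b′}` vanish once in each of the `k+2` gaps cut out by the zeros of `u_b` and
`t⋆` — `ncard_posts_succ_le` —, once too often; the sign is read off `𝒲′(0) = (b−b′)u_b(0)u_{b′}(0) > 0`.)
This is the Wronskian form of the interlacing of consecutive Sturm–Liouville eigenfunctions.
[cite: Hartman2002, Ch. XI §3 Thm 3.1 and Cor 3.1; CoddingtonLevinson1955, Ch. 8 §1 Thm 1.2] -/
theorem wronskian_frobSol_pos (hB : frobSol₁ 1 b 0 = 0) (hB' : frobSol₁ 1 b' 0 = 0)
    (hN : {x | x ∈ Ioo (0:ℝ) 1 ∧ frobSol 1 b x = 0}.ncard = k)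
    (hN' : {x | x ∈ Ioo (0:ℝ) 1 ∧ frobSol 1 b' x = 0}.ncard = k + 1) :
    ∀ x ∈ Ioo (0:ℝ) 1, 0 < frobSol 1 b x * ((1 ^ 2 - x ^ 2) * frobSol₁ 1 b' x)
      - (1 ^ 2 - x ^ 2) * frobSol₁ 1 b x * frobSol 1 b' x := by
  have hbb := lt_of_ncard_zeros_frobSol_succ hN hN'
  have hu := isProlateODESol_frobSol one_pos b
  have hv := isProlateODESol_frobSol one_pos b'
  have hS : Icc (0:ℝ) 1 ⊆ Ioo (-1) (3 * 1) := Icc_subset_Ioo_three one_pos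
  have hZu := finite_zeros_frobSol one_pos b
  have hZv := finite_zeros_frobSol one_pos b'
  set u := frobSol 1 b with hu_def
  set u₁ := frobSol₁ 1 b with hu₁_def
  set v := frobSol 1 b' with hv_def
  set v₁ := frobSol₁ 1 b' with hv₁_def
  set W : ℝ → ℝ := fun x ↦ u x * ((1 ^ 2 - x ^ 2) * v₁ x) - (1 ^ 2 - x ^ 2) * u₁ x * v x with hW
  have h0 : u 0 * ((1 ^ 2 - 0 ^ 2) * v₁ 0) - (1 ^ 2 - 0 ^ 2) * u₁ 0 * v 0 = 0 := by
    rw [show v₁ 0 = 0 from hB', show u₁ 0 = 0 from hB]; ring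
  -- (i) no zero of `W` in `(0,1)`
  have hne : ∀ x ∈ Ioo (0:ℝ) 1, W x ≠ 0 := by
    intro x hx hWx
    set Zu : Set ℝ := {x | x ∈ Ioo (0:ℝ) 1 ∧ u x = 0} with hZu_def
    set Zv : Set ℝ := {x | x ∈ Ioo (0:ℝ) 1 ∧ v x = 0} with hZv_def
    by_cases hux : u x = 0
    · -- `x` is a common zero
      have hvx : v x = 0 := by
        have hu₁x : u₁ x ≠ 0 := frobSol₁_ne_zero_of_zero one_pos b ⟨by linarith [hx.1], hx.2⟩ hux
        have hp : (1:ℝ) ^ 2 - x ^ 2 ≠ 0 := by nlinarith [hx.1, hx.2]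
        have : (1 ^ 2 - x ^ 2) * u₁ x * v x = 0 := by
          have h := hWx; simp only [hW, hux, zero_mul, zero_sub, neg_eq_zero] at h; exact h
        rcases mul_eq_zero.1 this with h | h
        · rcases mul_eq_zero.1 h with h | h
          · exact absurd h hp
          · exact absurd h hu₁x
        · exact h
      have hcount := ncard_posts_succ_le (P := Zu) one_pos hu hv hS hS hbb hZv hZu
        (fun p hp ↦ hp.1) (fun p hp ↦ Or.inl hp.2) (fun z hz huz ↦ ⟨hz, huz⟩) h0
      rw [hN] at hcount
      -- `x ∈ Zv ∩ Zu` is one more zero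
      have hsub : insert x {y | y ∈ Ioo (0:ℝ) 1 ∧ v y = 0 ∧ y ∉ Zu} ⊆ Zv := by
        intro y hy
        rcases hy with rfl | hy
        · exact ⟨hx, hvx⟩
        · exact ⟨hy.1, hy.2.1⟩
      have hxn : x ∉ {y | y ∈ Ioo (0:ℝ) 1 ∧ v y = 0 ∧ y ∉ Zu} := fun h ↦ h.2.2 ⟨hx, hux⟩
      have h1 := ncard_le_ncard hsub hZv
      rw [ncard_insert_of_notMem hxn (hZv.subset fun y hy ↦ ⟨hy.1, hy.2.1⟩), hN'] at h1
      omega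
    · -- `x` is a zero of `W` but not of `u`
      have hxZu : x ∉ Zu := fun h ↦ hux h.2
      have hcount := ncard_posts_succ_le (P := insert x Zu) one_pos hu hv hS hS hbb hZv
        (hZu.insert x) (fun p hp ↦ by rcases hp with rfl | hp; exacts [hx, hp.1])
        (fun p hp ↦ by rcases hp with rfl | hp; exacts [Or.inr hWx, Or.inl hp.2])
        (fun z hz huz ↦ Or.inr ⟨hz, huz⟩) h0
      rw [ncard_insert_of_notMem hxZu hZu, hN] at hcount
      have h1 : {y | y ∈ Ioo (0:ℝ) 1 ∧ v y = 0 ∧ y ∉ insert x Zu}.ncard ≤ Zv.ncard :=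
        ncard_le_ncard (fun y hy ↦ ⟨hy.1, hy.2.1⟩) hZv
      rw [hN'] at h1
      omega
  -- (ii) constant sign, (iii) positive near `0`
  have hWd : ∀ x ∈ Icc (0:ℝ) 1, HasDerivAt W ((b - b') * u x * v x) x := by
    intro x hx
    have h1 : HasDerivAt (fun y ↦ u y * ((1 ^ 2 - y ^ 2) * v₁ y))
        (u₁ x * ((1 ^ 2 - x ^ 2) * v₁ x) + u x * (((2 * π * 1 * x) ^ 2 - b') * v x)) x :=
      (hu.hasDerivAt x (hS hx)).mul (hv.hasDerivAt_flux (hS hx))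
    have h2 : HasDerivAt (fun y ↦ (1 ^ 2 - y ^ 2) * u₁ y * v y)
        (((2 * π * 1 * x) ^ 2 - b) * u x * v x + (1 ^ 2 - x ^ 2) * u₁ x * v₁ x) x :=
      (hu.hasDerivAt_flux (hS hx)).mul (hv.hasDerivAt x (hS hx))
    exact (h1.sub h2).congr_deriv (by ring)
  have hWc : ContinuousOn W (Ioo (0:ℝ) 1) := fun x hx ↦
    (hWd x (Ioo_subset_Icc_self hx)).continuousAt.continuousWithinAt
  rcases pos_or_neg_of_ne_zero zero_lt_one hWc hne with hpos | hneg
  · exact hpos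
  · exfalso
    -- signs at `0`: `(−1)^k u(0) > 0`, `(−1)^(k+1) v(0) > 0`
    have hder : ∀ (c : ℝ), ∀ z ∈ Ioo (0:ℝ) 1, frobSol 1 c z = 0 →
        ∃ d ≠ 0, HasDerivAt (frobSol 1 c) d z := fun c z hz hz0 ↦
      ⟨frobSol₁ 1 c z, frobSol₁_ne_zero_of_zero one_pos c ⟨by linarith [hz.1], hz.2⟩ hz0,
        hasDerivAt_frobSol one_pos c (by rw [abs_lt]; constructor <;> linarith [hz.1, hz.2])⟩
    have hu0ne : u 0 ≠ 0 := fun h ↦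
      frobSol₁_ne_zero_of_zero one_pos b ⟨by norm_num, by norm_num⟩ h hB
    have hv0ne : v 0 ≠ 0 := fun h ↦
      frobSol₁_ne_zero_of_zero one_pos b' ⟨by norm_num, by norm_num⟩ h hB'
    have hu0 : 0 < (-1 : ℝ) ^ k * u 0 :=
      pow_mul_pos_of_zeros zero_lt_one (continuousOn_frobSol_Icc one_pos b)
        (finite_zeros_frobSol one_pos b) hN (hder b) (by rw [hu_def, frobSol_self]; exact one_pos)
        hu0ne
    have hv0 : 0 < (-1 : ℝ) ^ (k + 1) * v 0 :=
      pow_mul_pos_of_zeros zero_lt_one (continuousOn_frobSol_Icc one_pos b')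
        (finite_zeros_frobSol one_pos b') hN' (hder b') (by rw [hv_def, frobSol_self]; exact one_pos)
        hv0ne
    have huv : u 0 * v 0 < 0 := by
      have h := mul_pos hu0 hv0
      have : ((-1 : ℝ) ^ k * u 0) * ((-1 : ℝ) ^ (k + 1) * v 0) = -(u 0 * v 0) := by
        rw [pow_succ]
        have h1 : ((-1 : ℝ) ^ k) * ((-1 : ℝ) ^ k) = 1 := by rw [← mul_pow]; norm_num
        linear_combination (-(u 0 * v 0)) * h1
      linarith
    have hW'0 : 0 < (b - b') * u 0 * v 0 := by
      have : (b - b') * u 0 * v 0 = (b' - b) * (-(u 0 * v 0)) := by ring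
      rw [this]; exact mul_pos (by linarith) (by linarith)
    -- `−W` vanishes at `0`, is positive on `(0,1)`, so `−W′(0) ≥ 0`
    have hmW : HasDerivAt (fun y ↦ -W y) (-((b - b') * u 0 * v 0)) 0 :=
      (hWd 0 (left_mem_Icc.2 zero_le_one)).neg
    have hW0 : (fun y ↦ -W y) 0 = 0 := by simp only [hW]; rw [h0, neg_zero]
    have := hasDerivAt_nonneg_of_pos_right hmW hW0 zero_lt_one
      (fun x hx ↦ by simpa using hneg x hx)
    linarith

/-- **`∫₀¹ x² u_b u_{b′} > 0` for consecutive critical parameters** (Frobenius normalisation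
`u(1) = 1`): with `𝒲′ = (b − b′)u_b u_{b′}` and `𝒲(0) = 𝒲(1) = 0`, an integration by parts gives
`(b − b′)∫₀¹x²u_bu_{b′} = −2∫₀¹x𝒲(x)dx < 0`. [folklore]
[cite: HoganLakey2012, Thm. 2.6.2 (the `x²`-pairings of prolate functions)] -/
theorem integral_sq_mul_frobSol_mul_pos (hB : frobSol₁ 1 b 0 = 0) (hB' : frobSol₁ 1 b' 0 = 0)
    (hN : {x | x ∈ Ioo (0:ℝ) 1 ∧ frobSol 1 b x = 0}.ncard = k)
    (hN' : {x | x ∈ Ioo (0:ℝ) 1 ∧ frobSol 1 b' x = 0}.ncard = k + 1) :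
    0 < ∫ x in (0:ℝ)..1, x ^ 2 * (frobSol 1 b x * frobSol 1 b' x) := by
  have hbb := lt_of_ncard_zeros_frobSol_succ hN hN'
  have hWpos := wronskian_frobSol_pos hB hB' hN hN'
  have hu := isProlateODESol_frobSol one_pos b
  have hv := isProlateODESol_frobSol one_pos b'
  have hS : Icc (0:ℝ) 1 ⊆ Ioo (-1) (3 * 1) := Icc_subset_Ioo_three one_pos
  set u := frobSol 1 b with hu_def
  set u₁ := frobSol₁ 1 b with hu₁_def
  set v := frobSol 1 b' with hv_def
  set v₁ := frobSol₁ 1 b' with hv₁_def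
  set W : ℝ → ℝ := fun x ↦ u x * ((1 ^ 2 - x ^ 2) * v₁ x) - (1 ^ 2 - x ^ 2) * u₁ x * v x with hW
  have hWd : ∀ x ∈ Icc (0:ℝ) 1, HasDerivAt W ((b - b') * u x * v x) x := by
    intro x hx
    have h1 : HasDerivAt (fun y ↦ u y * ((1 ^ 2 - y ^ 2) * v₁ y))
        (u₁ x * ((1 ^ 2 - x ^ 2) * v₁ x) + u x * (((2 * π * 1 * x) ^ 2 - b') * v x)) x :=
      (hu.hasDerivAt x (hS hx)).mul (hv.hasDerivAt_flux (hS hx))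
    have h2 : HasDerivAt (fun y ↦ (1 ^ 2 - y ^ 2) * u₁ y * v y)
        (((2 * π * 1 * x) ^ 2 - b) * u x * v x + (1 ^ 2 - x ^ 2) * u₁ x * v₁ x) x :=
      (hu.hasDerivAt_flux (hS hx)).mul (hv.hasDerivAt x (hS hx))
    exact (h1.sub h2).congr_deriv (by ring)
  have huc : ContinuousOn u (Icc 0 1) := (hu.continuousOn).mono hS
  have hvc : ContinuousOn v (Icc 0 1) := (hv.continuousOn).mono hS
  have hWc : ContinuousOn W (Icc (0:ℝ) 1) := fun x hx ↦ (hWd x hx).continuousAt.continuousWithinAt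
  -- `H = x² W`, `H′ = 2xW + x²(b−b′)uv`, `∫₀¹ H′ = H(1) − H(0) = 0`
  set H : ℝ → ℝ := fun x ↦ x ^ 2 * W x with hH
  have hHd : ∀ x ∈ uIcc (0:ℝ) 1,
      HasDerivAt H (2 * (x * W x) + (b - b') * (x ^ 2 * (u x * v x))) x := by
    intro x hx
    rw [uIcc_of_le zero_le_one] at hx
    have hp : HasDerivAt (fun y : ℝ ↦ y ^ 2) (2 * x) x := by simpa using hasDerivAt_pow 2 x
    exact (hp.mul (hWd x hx)).congr_deriv (by ring)
  have hi1 : IntervalIntegrable (fun x ↦ x * W x) volume 0 1 :=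
    ((continuousOn_id).mul hWc).intervalIntegrable_of_Icc zero_le_one
  have hi2 : IntervalIntegrable (fun x ↦ x ^ 2 * (u x * v x)) volume 0 1 :=
    ((Continuous.continuousOn (by fun_prop)).mul (huc.mul hvc)).intervalIntegrable_of_Icc
      zero_le_one
  have hint : IntervalIntegrable (fun x ↦ 2 * (x * W x) + (b - b') * (x ^ 2 * (u x * v x)))
      volume 0 1 := (hi1.const_mul 2).add (hi2.const_mul _)
  have hFTC := intervalIntegral.integral_eq_sub_of_hasDerivAt hHd hint
  have hH1 : H 1 = 0 := by simp [hH, hW]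
  have hH0 : H 0 = 0 := by simp [hH]
  rw [hH1, hH0, sub_zero, intervalIntegral.integral_add (hi1.const_mul 2) (hi2.const_mul _),
    intervalIntegral.integral_const_mul, intervalIntegral.integral_const_mul] at hFTC
  have hxW : 0 < ∫ x in (0:ℝ)..1, x * W x :=
    intervalIntegral_pos_of_pos_on hi1 (fun x hx ↦ mul_pos hx.1 (hWpos x hx)) zero_lt_one
  nlinarith

end Consecutive

/-! ## Assembly: `λ(k)² > λ(k+1)²` from the virial identity, and the discharge -/

/-- `∫_{−1}^{1} φ(|x|) dx = 2∫₀¹ φ(x) dx` for `φ` continuous on `[0,1]`. [folklore] -/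
private theorem integral_comp_abs_eq_two_mul {φ : ℝ → ℝ} (hφ : ContinuousOn φ (Icc 0 1)) :
    ∫ x in (-1:ℝ)..1, φ |x| = 2 * ∫ x in (0:ℝ)..1, φ x := by
  have habs : ContinuousOn (fun x ↦ φ |x|) (Icc (-1 : ℝ) 1) := by
    refine hφ.comp continuous_abs.continuousOn fun x hx ↦ ?_
    exact ⟨abs_nonneg x, abs_le.mpr ⟨hx.1, hx.2⟩⟩
  have hi1 : IntervalIntegrable (fun x ↦ φ |x|) volume (-1 : ℝ) 0 :=
    (habs.mono (Icc_subset_Icc le_rfl zero_le_one)).intervalIntegrable_of_Icc (by norm_num)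
  have hi2 : IntervalIntegrable (fun x ↦ φ |x|) volume (0 : ℝ) 1 :=
    (habs.mono (Icc_subset_Icc (by norm_num) le_rfl)).intervalIntegrable_of_Icc zero_le_one
  rw [← intervalIntegral.integral_add_adjacent_intervals hi1 hi2]
  have hleft : ∫ x in (-1:ℝ)..0, φ |x| = ∫ x in (0:ℝ)..1, φ x := by
    have hc : EqOn (fun x ↦ φ |x|) (fun x ↦ φ (-x)) (uIcc (-1 : ℝ) 0) := by
      intro x hx
      rw [uIcc_of_le (by norm_num)] at hx
      simp only [abs_of_nonpos hx.2]
    rw [intervalIntegral.integral_congr hc, intervalIntegral.integral_comp_neg (fun x ↦ φ x)]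
    simp
  have hright : ∫ x in (0:ℝ)..1, φ |x| = ∫ x in (0:ℝ)..1, φ x := by
    refine intervalIntegral.integral_congr fun x hx ↦ ?_
    rw [uIcc_of_le zero_le_one] at hx
    simp only [abs_of_nonneg hx.1]
  rw [hleft, hright]
  ring

/-- **`λ(k)² > λ(k+1)²`, given the virial identity** (D) for the pair `(k, k+1)`:
`(λ_k² − λ_{k+1}²)·∫_{−1}^{1}x²ψ_kψ_{k+1} = λ_kλ_{k+1}(χ_k − χ_{k+1})ψ_k(1)ψ_{k+1}(1)/(2π)²` for the
eigenvalues `χ_k, χ_{k+1}` of `𝐖` on `ψ_k = prolateFun k`, `ψ_{k+1}` (hypothesis `hD`, in the shape of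
`IsProlateFunction.eigen`; proved in `ProlateEigenvalueVirial.lean`).  With `ψ_j = C_j·u_{b_j}(|x|)`
(`prolateFun_eq_frobEvenExt`), `∫_{−1}^{1}x²ψ_kψ_{k+1} = 2C_kC_{k+1}∫₀¹x²u_bu_{b′}`, `ψ_j(1) = C_j`,
so (D) becomes `(λ_k² − λ_{k+1}²)·2∫₀¹x²u_bu_{b′} = λ_kλ_{k+1}(b − b′)/(2π)² > 0`
(`prolateEigen_mul_succ_neg`, `b < b′`), and `∫₀¹x²u_bu_{b′} > 0` (`integral_sq_mul_frobSol_mul_pos`).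
[cite: SlepianPollak1961, §III] [cite: RokhlinXiao2007, Thm. 3 p. 109]
[cite: HoganLakey2012, Thm. 1.2.8 and Thm. 2.6.2] -/
theorem sq_prolateEigen_succ_lt_of_virial (k : ℕ)
    (hD : ∀ {χ χ' : ℝ},
      (∀ x ∈ Ioo (-1:ℝ) 1, -(deriv (fun y ↦ (1 ^ 2 - y ^ 2) * deriv (prolateFun k) y) x)
          + (2 * π * 1 * x) ^ 2 * prolateFun k x = χ * prolateFun k x) →
      (∀ x ∈ Ioo (-1:ℝ) 1, -(deriv (fun y ↦ (1 ^ 2 - y ^ 2) * deriv (prolateFun (k + 1)) y) x)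
          + (2 * π * 1 * x) ^ 2 * prolateFun (k + 1) x = χ' * prolateFun (k + 1) x) →
      (prolateEigen k ^ 2 - prolateEigen (k + 1) ^ 2)
          * (∫ x in (-1:ℝ)..1, x ^ 2 * (prolateFun k x * prolateFun (k + 1) x))
        = prolateEigen k * prolateEigen (k + 1) * (χ - χ')
          * (prolateFun k 1 * prolateFun (k + 1) 1) / (2 * π) ^ 2) :
    prolateEigen (k + 1) ^ 2 < prolateEigen k ^ 2 := by
  obtain ⟨b, hB, hN⟩ := exists_frobSol₁_zero_eq one_pos k
  obtain ⟨b', hB', hN'⟩ := exists_frobSol₁_zero_eq one_pos (k + 1)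
  rw [frobZeros_def] at hN hN'
  have hbb := lt_of_ncard_zeros_frobSol_succ hN hN'
  have hI := integral_sq_mul_frobSol_mul_pos hB hB' hN hN'
  have hlam := prolateEigen_mul_succ_neg k
  -- eigen-equations of `ψ_k`, `ψ_{k+1}` with `χ = b`, `χ′ = b′`
  have hek := (isProlateFunction_frobEvenExt hB hN).2
  rw [← prolateFun_eq_frobEvenExt hB hN] at hek
  have hek' := (isProlateFunction_frobEvenExt hB' hN').2
  rw [← prolateFun_eq_frobEvenExt hB' hN'] at hek'
  have hDk := hD hek hek'
  -- `ψ_j = C_j u_{b_j}(|x|)` on `[−1, 1]`, `ψ_j(1) = C_j`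
  set C := frobNormConst b with hC
  set C' := frobNormConst b' with hC'
  have hψ : ∀ x ∈ uIcc (-1:ℝ) 1, x ^ 2 * (prolateFun k x * prolateFun (k + 1) x)
      = C * C' * (|x| ^ 2 * (frobSol 1 b |x| * frobSol 1 b' |x|)) := by
    intro x hx
    rw [uIcc_of_le (by norm_num)] at hx
    have hxabs : |x| ≤ 1 := abs_le.mpr ⟨hx.1, hx.2⟩
    rw [prolateFun_eq_frobEvenExt hB hN, prolateFun_eq_frobEvenExt hB' hN', sq_abs]
    simp only [frobEvenExt, if_pos hxabs]
    ring
  have hψ1 : prolateFun k 1 * prolateFun (k + 1) 1 = C * C' := by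
    rw [prolateFun_eq_frobEvenExt hB hN, prolateFun_eq_frobEvenExt hB' hN']
    simp [frobEvenExt, frobSol_self, hC, hC']
  have hint : ∫ x in (-1:ℝ)..1, x ^ 2 * (prolateFun k x * prolateFun (k + 1) x)
      = C * C' * (2 * ∫ x in (0:ℝ)..1, x ^ 2 * (frobSol 1 b x * frobSol 1 b' x)) := by
    rw [intervalIntegral.integral_congr hψ, intervalIntegral.integral_const_mul,
      integral_comp_abs_eq_two_mul (φ := fun t ↦ t ^ 2 * (frobSol 1 b t * frobSol 1 b' t))]
    exact (Continuous.continuousOn (by fun_prop)).mul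
      ((continuousOn_frobSol_Icc one_pos b).mul (continuousOn_frobSol_Icc one_pos b'))
  have hCC : C * C' ≠ 0 := by
    rw [← hψ1]
    refine mul_ne_zero (fun h ↦ ?_) (fun h ↦ ?_)
    · have := prolateFun_one_sq_eq_of_frobSol hB hN
      rw [h] at this
      have hpos : 0 < 1 / (2 * ∫ x in (0:ℝ)..1, frobSol 1 b x ^ 2) := by
        have := integral_frobSol_sq_pos one_pos b; positivity
      linarith [this]
    · have := prolateFun_one_sq_eq_of_frobSol hB' hN'
      rw [h] at this
      have hpos : 0 < 1 / (2 * ∫ x in (0:ℝ)..1, frobSol 1 b' x ^ 2) := by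
        have := integral_frobSol_sq_pos one_pos b'; positivity
      linarith [this]
  rw [hint, hψ1] at hDk
  -- cancel `C C'`
  set I := ∫ x in (0:ℝ)..1, x ^ 2 * (frobSol 1 b x * frobSol 1 b' x) with hI_def
  have hred : (prolateEigen k ^ 2 - prolateEigen (k + 1) ^ 2) * (2 * I)
      = prolateEigen k * prolateEigen (k + 1) * (b - b') / (2 * π) ^ 2 := by
    have h2 : C * C' * ((prolateEigen k ^ 2 - prolateEigen (k + 1) ^ 2) * (2 * I))
        = C * C' * (prolateEigen k * prolateEigen (k + 1) * (b - b') / (2 * π) ^ 2) := by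
      have := hDk
      field_simp at this ⊢
      linear_combination this
    exact mul_left_cancel₀ hCC h2
  have hR : 0 < prolateEigen k * prolateEigen (k + 1) * (b - b') / (2 * π) ^ 2 := by
    apply div_pos _ (by positivity)
    exact mul_pos_of_neg_of_neg hlam (by linarith)
  rw [← hred] at hR
  have h2I : 0 < 2 * I := by positivity
  have : 0 < prolateEigen k ^ 2 - prolateEigen (k + 1) ^ 2 := (pos_iff_pos_of_mul_pos hR).2 h2I
  linarith

/-! ## The discharge: clause 3 and `CC2021_sec4_lambda_basic_holds` (append; imports `ProlateEigenvalueVirial`) -/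

/-- **`λ(k+1)² < λ(k)²`** — the virial identity (D) of `ProlateEigenvalueVirial.lean` fed into
`sq_prolateEigen_succ_lt_of_virial`. [cite: SlepianPollak1961, §III] [cite: RokhlinXiao2007, Thm. 3 p. 109]
[cite: HoganLakey2012, Thm. 1.2.8] -/
theorem sq_prolateEigen_succ_lt (k : ℕ) : prolateEigen (k + 1) ^ 2 < prolateEigen k ^ 2 :=
  sq_prolateEigen_succ_lt_of_virial k fun hn hm ↦
    prolateEigen_sq_sub_sq_mul_integral_sq_mul k (k + 1) hn hm

/-- **`|λ(k+1)| < |λ(k)|`.** [cite: ConnesConsani2021, §4 p. 16 (arXiv p0016:L22–L25)]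
[cite: RokhlinXiao2007, Thm. 3 p. 109] -/
theorem abs_prolateEigen_succ_lt (k : ℕ) : |prolateEigen (k + 1)| < |prolateEigen k| :=
  sq_lt_sq.1 (sq_prolateEigen_succ_lt k)

/-- **Clause 3 of `CC2021_sec4_lambda_basic`: the moduli `|λ(n)|` are strictly decreasing** ("`|λ_0| >
|λ_1| > ⋯`"; Connes 2026 Letter Fact 6.3 "`1 > ν_0 > ν_1 > ⋯`", `ν_n = λ(n)²`).
[cite: ConnesConsani2021, §4 p. 16 (arXiv p0016:L22–L25)] [cite: SlepianPollak1961, §III]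
[cite: RokhlinXiao2007, Thm. 3 p. 109] [cite: HoganLakey2012, Thm. 1.2.8] -/
theorem strictAnti_abs_prolateEigen : StrictAnti (fun n : ℕ ↦ |prolateEigen n|) :=
  strictAnti_nat_of_succ_lt fun n ↦ abs_prolateEigen_succ_lt n

/-- Non-degeneracy of the moduli: `|λ(n)| ≠ |λ(m)|` for `n ≠ m` (simplicity of the spectrum of
`𝒫₁𝒫̂₁𝒫₁` on the even functions). [cite: SlepianPollak1961, §III] [cite: HoganLakey2012, Thm. 1.2.8] -/
theorem abs_prolateEigen_injective : Function.Injective (fun n : ℕ ↦ |prolateEigen n|) :=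
  strictAnti_abs_prolateEigen.injective

/-- **`CC2021_sec4_lambda_basic` holds**: the printed qualitative facts about the `λ(n)` — sign `(−1)ⁿ`
(clause 1, `ProlateEigenvalueSigns.lean`), `|λ(n)| < 1` (clause 2, seat t3's `abs_prolateEigen_lt_one`),
`|λ(n)|` strictly decreasing (clause 3, this file with the virial identity of `ProlateEigenvalueVirial.lean`),
`λ(n) → 0` (clause 4, seat gm-t14's `tendsto_prolateEigen_zero`) — are tree theorems; the named fact is
DISCHARGED.  RH-FREE.
[cite: ConnesConsani2021, §4 p. 16 (arXiv p0016:L22–L25)] [cite: RokhlinXiao2007, Thm. 3 p. 109]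
[cite: SlepianPollak1961, §III] [cite: Connes2026Letter, §6.3 Fact 6.3] -/
theorem CC2021_sec4_lambda_basic_holds : CC2021_sec4_lambda_basic :=
  ⟨neg_one_pow_mul_prolateEigen_pos, abs_prolateEigen_lt_one, strictAnti_abs_prolateEigen,
    tendsto_prolateEigen_zero⟩

/-! ## Index bookkeeping from the ordering of the moduli (corollaries; RH-FREE)

One-line consequences of `strictAnti_abs_prolateEigen` in the shapes the archimedean-kernel certificate
of the cell consumes (`ArchKernelModeIdentification.lean`, `EpsSlopeTailFrame.lean`,
`ArchKernelL1Certificate.lean`): monotone bounds on the tail factors `|λ(n)|`, `λ(n)²`,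
`λ(n)²/(1 − λ(n)²)` for `n ≥ N`, the selection principle «an eigenvalue of modulus above `|λ(N)|` is one
of `λ(0), …, λ(N−1)`», and the **λ-route to identification by index** (the `|λ|`-twin of
`prolate_index_eq_of_eigen_strictMono` / `eq_prolateFun_of_exists_index_of_eigen_strictMono`, which use
the Sturm–Liouville eigenvalues `χ` and Wang's cap instead): certified members with strictly DECREASING
moduli `|μ_0| > ⋯ > |μ_{N−1}|` that dominate `|λ(N)|` — or that leave a trace gap
`Λ − Σ_{j<N} μ_j² < μ_j²` — are `prolateFun 0, …, prolateFun (N−1)` in order.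
[cite: ConnesConsani2021, §4 p. 16 (arXiv p0016:L22–L25)] [cite: SlepianPollak1961, §III] -/

/-- The moduli `n ↦ |λ(n)|` are antitone. [cite: ConnesConsani2021, §4 p. 16 (arXiv p0016:L22–L25)] -/
theorem antitone_abs_prolateEigen : Antitone (fun n : ℕ ↦ |prolateEigen n|) :=
  strictAnti_abs_prolateEigen.antitone

/-- `|λ(n)| < |λ(m)|` for `m < n`. [cite: ConnesConsani2021, §4 p. 16 (arXiv p0016:L22–L25)] -/
theorem abs_prolateEigen_lt_of_lt {m n : ℕ} (h : m < n) : |prolateEigen n| < |prolateEigen m| :=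
  strictAnti_abs_prolateEigen h

/-- `|λ(n)| ≤ |λ(m)|` for `m ≤ n`. [cite: ConnesConsani2021, §4 p. 16 (arXiv p0016:L22–L25)] -/
theorem abs_prolateEigen_le_of_le {m n : ℕ} (h : m ≤ n) : |prolateEigen n| ≤ |prolateEigen m| :=
  antitone_abs_prolateEigen h

/-- `|λ(n)| < |λ(m)| ↔ m < n`. [cite: ConnesConsani2021, §4 p. 16 (arXiv p0016:L22–L25)] -/
theorem abs_prolateEigen_lt_iff {m n : ℕ} : |prolateEigen n| < |prolateEigen m| ↔ m < n :=
  strictAnti_abs_prolateEigen.lt_iff_gt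

/-- `|λ(n)| ≤ |λ(m)| ↔ m ≤ n`. [cite: ConnesConsani2021, §4 p. 16 (arXiv p0016:L22–L25)] -/
theorem abs_prolateEigen_le_iff {m n : ℕ} : |prolateEigen n| ≤ |prolateEigen m| ↔ m ≤ n :=
  strictAnti_abs_prolateEigen.le_iff_ge

/-- `λ(n)² < λ(m)²` for `m < n`. [cite: ConnesConsani2021, §4 p. 16 (arXiv p0016:L22–L25)] -/
theorem sq_prolateEigen_lt_of_lt {m n : ℕ} (h : m < n) : prolateEigen n ^ 2 < prolateEigen m ^ 2 :=
  sq_lt_sq.2 (abs_prolateEigen_lt_of_lt h)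

/-- `λ(n)² ≤ λ(m)²` for `m ≤ n`: every tail weight `λ(n)²`, `n ≥ N`, is at most `λ(N)²`.
[cite: ConnesConsani2021, §4 p. 16 (arXiv p0016:L22–L25)] -/
theorem sq_prolateEigen_le_of_le {m n : ℕ} (h : m ≤ n) : prolateEigen n ^ 2 ≤ prolateEigen m ^ 2 :=
  sq_le_sq.2 (abs_prolateEigen_le_of_le h)

/-- `λ(n)² < 1` (clause 2, squared). [cite: ConnesConsani2021, §4 p. 16 ("ν_n = λ(n)² < 1")] -/
theorem sq_prolateEigen_lt_one (n : ℕ) : prolateEigen n ^ 2 < 1 :=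
  (sq_lt_one_iff_abs_lt_one _).2 (abs_prolateEigen_lt_one n)

/-- The Sonine/slope weights are antitone too: `λ(n)²/(1 − λ(n)²) ≤ λ(m)²/(1 − λ(m)²)` for `m ≤ n`
(`x ↦ x/(1−x)` is monotone on `[0,1)`). [cite: ConnesConsani2021, §4 p. 16; Lemma 5.4 §5 p. 32] -/
theorem sq_div_one_sub_sq_prolateEigen_le_of_le {m n : ℕ} (h : m ≤ n) :
    prolateEigen n ^ 2 / (1 - prolateEigen n ^ 2) ≤ prolateEigen m ^ 2 / (1 - prolateEigen m ^ 2) := by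
  have h1 : prolateEigen n ^ 2 ≤ prolateEigen m ^ 2 := sq_prolateEigen_le_of_le h
  have hm : prolateEigen m ^ 2 < 1 := sq_prolateEigen_lt_one m
  have hn : prolateEigen n ^ 2 < 1 := sq_prolateEigen_lt_one n
  rw [div_le_div_iff₀ (by linarith) (by linarith)]
  nlinarith [sq_nonneg (prolateEigen n), sq_nonneg (prolateEigen m)]

/-- **Selection by modulus**: if `|λ(N)| < |λ(m)|` then `m < N` — an eigenvalue whose modulus exceeds
`|λ(N)|` is one of `λ(0), …, λ(N−1)`. [cite: ConnesConsani2021, §4 p. 16 (arXiv p0016:L22–L25)] -/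
theorem lt_of_abs_prolateEigen_lt {m N : ℕ} (h : |prolateEigen N| < |prolateEigen m|) : m < N :=
  abs_prolateEigen_lt_iff.1 h

/-- Selection by modulus, eigenvalue form: a member `μ` of the sequence `(λ(m))` with `|λ(N)| < |μ|` is
`λ(m)` for some `m < N`. [cite: ConnesConsani2021, §4 p. 16 (arXiv p0016:L22–L25)] -/
theorem exists_lt_eq_prolateEigen_of_abs_lt {μ : ℝ} {N : ℕ} (hμ : ∃ m : ℕ, μ = prolateEigen m)
    (h : |prolateEigen N| < |μ|) : ∃ m < N, μ = prolateEigen m := by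
  obtain ⟨m, rfl⟩ := hμ
  exact ⟨m, lt_of_abs_prolateEigen_lt h, rfl⟩

/-- Combinatorial core of identification by ordering: a map `j ↦ k_j` that is strictly increasing on
`j < N` with all values `< N` is the identity there. [folklore] -/
private theorem index_eq_of_strictMono_of_lt {N : ℕ} {k : ℕ → ℕ}
    (hstrict : ∀ j, j + 1 < N → k j < k (j + 1)) (htop : ∀ j < N, k j < N) :
    ∀ j < N, k j = j := by
  -- lower bound `j ≤ k j`
  have hlow : ∀ j < N, j ≤ k j := by
    intro j
    induction j with
    | zero => intro _; exact Nat.zero_le _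
    | succ i ih =>
      intro hi
      have h1 := ih (by omega)
      have h2 := hstrict i hi
      omega
  -- upper bound: `k (N - 1 - i) + i ≤ k (N - 1)`
  have hup : ∀ i < N, k (N - 1 - i) + i ≤ k (N - 1) := by
    intro i
    induction i with
    | zero => intro _; simp
    | succ i ih =>
      intro hi
      have h1 := ih (by omega)
      have h2 := hstrict (N - 1 - (i + 1)) (by omega)
      have e : N - 1 - (i + 1) + 1 = N - 1 - i := by omega
      rw [e] at h2
      omega
  intro j hj
  have htopk : k (N - 1) < N := htop (N - 1) (by omega)
  have h1 := hlow j hj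
  have h2 := hup (N - 1 - j) (by omega)
  have e : N - 1 - (N - 1 - j) = j := by omega
  rw [e] at h2
  omega

/-- **λ-route to identification, index form**: indices `k_0, …, k_{N−1}` whose moduli `|λ(k_j)|` are
strictly decreasing in `j` and all exceed `|λ(N)|` are `k_j = j` (`|λ|` is strictly decreasing, so
`j ↦ k_j` is strictly increasing with values `< N`).  The `|λ|`-twin of
`prolate_index_eq_of_eigen_strictMono` (which orders the Sturm–Liouville eigenvalues `χ` instead).
[cite: ConnesConsani2021, §4 p. 16 (arXiv p0016:L22–L25)] [cite: SlepianPollak1961, §III] -/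
theorem prolate_index_eq_of_abs_prolateEigen_strictAnti {N : ℕ} {k : ℕ → ℕ}
    (hanti : ∀ j, j + 1 < N → |prolateEigen (k (j + 1))| < |prolateEigen (k j)|)
    (htop : ∀ j < N, |prolateEigen N| < |prolateEigen (k j)|) : ∀ j < N, k j = j :=
  index_eq_of_strictMono_of_lt (fun j hj ↦ abs_prolateEigen_lt_iff.1 (hanti j hj))
    (fun j hj ↦ lt_of_abs_prolateEigen_lt (htop j hj))

/-- **λ-route to identification, domination form**: indices `k_0, …, k_{N−1}` with strictly decreasing
moduli `|λ(k_j)|` such that every index `m` NOT among the `k_j` has `|λ(m)| < |λ(k_j)|` for all `j < N`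
(«the selected eigenvalues are the `N` largest in modulus») are `k_j = j`.  Pigeonhole: if some
`k_{j₀} ≥ N`, an index `i < N` is missed, and domination at `i` forces every `k_j < i < N`.
[cite: ConnesConsani2021, §4 p. 16 (arXiv p0016:L22–L25)] [cite: SlepianPollak1961, §III] -/
theorem prolate_index_eq_of_abs_prolateEigen_dominates {N : ℕ} {k : ℕ → ℕ}
    (hanti : ∀ j, j + 1 < N → |prolateEigen (k (j + 1))| < |prolateEigen (k j)|)
    (hdom : ∀ m : ℕ, (∀ j < N, k j ≠ m) → ∀ j < N, |prolateEigen m| < |prolateEigen (k j)|) :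
    ∀ j < N, k j = j := by
  classical
  have hstrict : ∀ j, j + 1 < N → k j < k (j + 1) := fun j hj ↦ abs_prolateEigen_lt_iff.1 (hanti j hj)
  -- `k` is strictly monotone, hence injective, on `range N`
  have hmono : ∀ i j, j < N → i < j → k i < k j := by
    intro i j hj hij
    induction j with
    | zero => omega
    | succ j ih =>
      rcases Nat.lt_succ_iff_lt_or_eq.1 hij with h | h
      · exact (ih (by omega) h).trans (hstrict j hj)
      · subst h; exact hstrict i hj
  have hinj : Set.InjOn k (Finset.range N : Set ℕ) := by
    intro i hi j hj hij
    simp only [Finset.coe_range, Set.mem_Iio] at hi hj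
    rcases lt_trichotomy i j with h | h | h
    · exact absurd hij (hmono i j hj h).ne
    · exact h
    · exact absurd hij (hmono j i hi h).ne'
  refine index_eq_of_strictMono_of_lt hstrict fun j₀ hj₀ ↦ ?_
  by_contra hge
  push Not at hge
  -- some `i < N` is not a value `k j`, `j < N`
  have hmiss : ∃ i < N, ∀ j < N, k j ≠ i := by
    by_contra hall
    push Not at hall
    have hsub : Finset.range N ⊆ (Finset.range N).image k := by
      intro i hi
      obtain ⟨j, hj, hji⟩ := hall i (Finset.mem_range.1 hi)
      exact Finset.mem_image.2 ⟨j, Finset.mem_range.2 hj, hji⟩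
    have hcard : ((Finset.range N).image k).card ≤ (Finset.range N).card := by
      rw [Finset.card_image_of_injOn hinj]
    have heq : Finset.range N = (Finset.range N).image k := Finset.eq_of_subset_of_card_le hsub hcard
    have hmem : k j₀ ∈ (Finset.range N).image k :=
      Finset.mem_image.2 ⟨j₀, Finset.mem_range.2 hj₀, rfl⟩
    rw [← heq, Finset.mem_range] at hmem
    omega
  obtain ⟨i, hi, hki⟩ := hmiss
  have h := lt_of_abs_prolateEigen_lt (hdom i hki j₀ hj₀)
  omega

/-- For a certified member `u = h_{2k,1}` the index-free quotient `(∫_{−1}^{1} u)/u(0)` IS `λ(k)`.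
[cite: ConnesConsani2021, §4 p. 16 eq. (cosalphan) (arXiv p0016:L25–L28)] -/
theorem _root_.Literature.NumberTheory.LFunctions.IsProlateFunction.intervalIntegral_div_eq_prolateEigen
    {k : ℕ} {u : ℝ → ℝ} (hu : IsProlateFunction 1 (2 * k) u) :
    (∫ x in (-1 : ℝ)..1, u x) / u 0 = prolateEigen k := by
  rw [eq_prolateFun_of_isProlateFunction hu, prolateEigen_eq_intervalIntegral]

/-- **λ-route to identification, member form** (the `|λ|`-twin of
`eq_prolateFun_of_exists_index_of_eigen_strictMono`): even prolate members `u_j` (`j < N`, each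
`h_{2k,1}` for SOME `k`, as an index-free certificate delivers them) whose index-free eigenvalue quotients
`μ_j = (∫_{−1}^{1} u_j)/u_j(0)` have strictly decreasing moduli, all above `|λ(N)|`, are
`u_j = prolateFun j`. [cite: ConnesConsani2021, §4 p. 16 (arXiv p0016:L22–L28)] [cite: SlepianPollak1961, §III] -/
theorem eq_prolateFun_of_abs_eigen_strictAnti {N : ℕ} {u : ℕ → ℝ → ℝ} {μ : ℕ → ℝ}
    (hu : ∀ j < N, ∃ k : ℕ, IsProlateFunction 1 (2 * k) (u j))
    (hμ : ∀ j < N, (∫ x in (-1 : ℝ)..1, u j x) / u j 0 = μ j)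
    (hanti : ∀ j, j + 1 < N → |μ (j + 1)| < |μ j|)
    (htop : ∀ j < N, |prolateEigen N| < |μ j|) : ∀ j < N, u j = prolateFun j := by
  classical
  let k : ℕ → ℕ := fun j ↦ if h : j < N then (hu j h).choose else 0
  have hk : ∀ j < N, IsProlateFunction 1 (2 * k j) (u j) := by
    intro j hj
    simp only [k, dif_pos hj]
    exact (hu j hj).choose_spec
  have hμk : ∀ j < N, μ j = prolateEigen (k j) := fun j hj ↦ by
    rw [← hμ j hj, (hk j hj).intervalIntegral_div_eq_prolateEigen]
  have hid : ∀ j < N, k j = j :=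
    prolate_index_eq_of_abs_prolateEigen_strictAnti
      (fun j hj ↦ by rw [← hμk j (by omega), ← hμk (j + 1) hj]; exact hanti j hj)
      (fun j hj ↦ by rw [← hμk j hj]; exact htop j hj)
  intro j hj
  have h := hk j hj
  rw [hid j hj] at h
  exact eq_prolateFun_of_isProlateFunction h

/-- **λ-route to identification, trace-gap form**: as `eq_prolateFun_of_abs_eigen_strictAnti`, with the
domination of the uncertified eigenvalues supplied by a TRACE BOUND `hΛ` (every `λ(m)²` with `m` outside a
finite set `F` is at most `Λ − Σ_{i∈F} λ(i)²` — e.g. `Λ = Σ' λ(n)² = 2(Si(4π)/(4π) + 1)` of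
`ProlateEigenvalueTailMass.lean`, or the crude `5/2 + 3/(2π)` of `EpsSlopeTailFrame.lean`) and the
certified gap `Λ − Σ_{j<N} μ_j² < μ_j²` for every `j < N`: then `u_j = prolateFun j`.
[cite: ConnesConsani2021, §4 p. 16 (arXiv p0016:L22–L28); Lemma 5.4 §5 p. 33] [cite: SlepianPollak1961, §III] -/
theorem eq_prolateFun_of_sq_eigen_gap {N : ℕ} {u : ℕ → ℝ → ℝ} {μ : ℕ → ℝ} {Λ : ℝ}
    (hu : ∀ j < N, ∃ k : ℕ, IsProlateFunction 1 (2 * k) (u j))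
    (hμ : ∀ j < N, (∫ x in (-1 : ℝ)..1, u j x) / u j 0 = μ j)
    (hanti : ∀ j, j + 1 < N → |μ (j + 1)| < |μ j|)
    (hΛ : ∀ (F : Finset ℕ) (m : ℕ), m ∉ F → prolateEigen m ^ 2 ≤ Λ - ∑ i ∈ F, prolateEigen i ^ 2)
    (hgap : ∀ j < N, Λ - ∑ i ∈ Finset.range N, μ i ^ 2 < μ j ^ 2) :
    ∀ j < N, u j = prolateFun j := by
  classical
  let k : ℕ → ℕ := fun j ↦ if h : j < N then (hu j h).choose else 0
  have hk : ∀ j < N, IsProlateFunction 1 (2 * k j) (u j) := by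
    intro j hj
    simp only [k, dif_pos hj]
    exact (hu j hj).choose_spec
  have hμk : ∀ j < N, μ j = prolateEigen (k j) := fun j hj ↦ by
    rw [← hμ j hj, (hk j hj).intervalIntegral_div_eq_prolateEigen]
  have hanti' : ∀ j, j + 1 < N → |prolateEigen (k (j + 1))| < |prolateEigen (k j)| :=
    fun j hj ↦ by rw [← hμk j (by omega), ← hμk (j + 1) hj]; exact hanti j hj
  -- strict monotonicity ⇒ injectivity of `k` on `range N`
  have hstrict : ∀ j, j + 1 < N → k j < k (j + 1) := fun j hj ↦ abs_prolateEigen_lt_iff.1 (hanti' j hj)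
  have hmono : ∀ i j, j < N → i < j → k i < k j := by
    intro i j hj hij
    induction j with
    | zero => omega
    | succ j ih =>
      rcases Nat.lt_succ_iff_lt_or_eq.1 hij with h | h
      · exact (ih (by omega) h).trans (hstrict j hj)
      · subst h; exact hstrict i hj
  have hinj : ∀ i < N, ∀ j < N, k i = k j → i = j := by
    intro i hi j hj hij
    rcases lt_trichotomy i j with h | h | h
    · exact absurd hij (hmono i j hj h).ne
    · exact h
    · exact absurd hij (hmono j i hi h).ne'
  -- the certified sum is the sum over the image finset
  have hsum : ∑ i ∈ Finset.range N, μ i ^ 2 = ∑ i ∈ (Finset.range N).image k, prolateEigen i ^ 2 := by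
    rw [Finset.sum_image (fun i hi j hj hij ↦
      hinj i (Finset.mem_range.1 hi) j (Finset.mem_range.1 hj) hij)]
    exact Finset.sum_congr rfl fun i hi ↦ by rw [hμk i (Finset.mem_range.1 hi)]
  have hdom : ∀ m : ℕ, (∀ j < N, k j ≠ m) → ∀ j < N, |prolateEigen m| < |prolateEigen (k j)| := by
    intro m hm j hj
    have hnot : m ∉ (Finset.range N).image k := by
      intro h
      obtain ⟨i, hi, him⟩ := Finset.mem_image.1 h
      exact hm i (Finset.mem_range.1 hi) him
    have h1 := hΛ _ m hnot
    have h2 := hgap j hj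
    rw [hsum] at h2
    rw [hμk j hj] at h2
    exact sq_lt_sq.1 (by linarith)
  have hid : ∀ j < N, k j = j := prolate_index_eq_of_abs_prolateEigen_dominates hanti' hdom
  intro j hj
  have h := hk j hj
  rw [hid j hj] at h
  exact eq_prolateFun_of_isProlateFunction h

end Literature.NumberTheory.ConnesConsani2021
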